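import Mathlib.RingTheory.LocalRing.Length
import Mathlib.Algebra.GroupWithZero.Units.Lemmas
import HarnessLib

/-!
# Length over a local algebra with trivial residue extension is the dimension over the ground field

`Literature/RingTheory/Length/LengthEqFinrank.lean`, namespace `Literature.RingTheory.Length`
(companion of `ColengthFinrank.lean`). Let `κ` be a field and `R` a local `κ`-algebra whose residue
field is `κ` in the concrete sense that every element of `R` is congruent to a scalar modulo the
maximal ideal (e.g. `R = κ⟦x₁,…,xₙ⟧`, `R = κ⟦x⟧ ⧸ I`, the local ring of a `κ`-rational point). Then for
every `R`-module `M` (with the compatible `κ`-structure):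

* `length_eq_finrank_of_residueField` — `ℓ_R(M) = dim_κ M` when `M` is finite-dimensional over `κ`;
* `finite_of_length_ne_top_of_residueField` — conversely a finite-length `R`-module is
  finite-dimensional over `κ`.

This is the bridge between the LENGTH-valued statements of commutative algebra (Hilbert–Samuel,
Huneke–Swanson's colength formulas, `Module.length`) and the DIMENSION counts (`Module.finrank κ`) used
for Milnor / Tjurina numbers and intersection multiplicities over a field. It is the special case
`[κ(R) : κ] = 1` of `ℓ_κ(M) = ℓ_R(M) · [κ(R) : κ]` (Mathlib `IsLocalRing.length_restrictScalars`).
Standard: Fulton, *Intersection Theory* (2nd ed.), Appendix A.1 (Lemma A.1.3 and Example A.1.1).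
Everything is PROVED; no definitions.

## References
* [Fulton1998] W. Fulton, Intersection Theory, 2nd ed., Springer 1998, Appendix A.1.
-/

namespace Literature.RingTheory.Length

open IsLocalRing Module

variable {κ : Type*} [Field κ] {R : Type*} [CommRing R] [IsLocalRing R] [Algebra κ R]

/-- The structure map of a local algebra over a field is a local homomorphism. [folklore] -/
theorem isLocalHom_algebraMap_of_field : IsLocalHom (algebraMap κ R) :=
  isLocalHom_of_exists_map_ne_one ⟨0, by simp⟩

/-- If every element of the local `κ`-algebra `R` is congruent to a scalar modulo `𝔪_R`, the scalar
map `κ → κ(R)` is bijective. [folklore] -/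
theorem bijective_algebraMap_residueField_of_forall_sub_mem
    (hres : ∀ r : R, ∃ c : κ, r - algebraMap κ R c ∈ maximalIdeal R) :
    Function.Bijective (algebraMap κ (ResidueField R)) := by
  refine ⟨(algebraMap κ (ResidueField R)).injective, fun y => ?_⟩
  obtain ⟨r, rfl⟩ := residue_surjective y
  obtain ⟨c, hc⟩ := hres r
  refine ⟨c, ?_⟩
  rw [IsScalarTower.algebraMap_apply κ R (ResidueField R), ResidueField.algebraMap_eq, eq_comm,
    ← sub_eq_zero, ← map_sub, residue_eq_zero_iff]
  exact hc

/-- Under the same hypothesis `κ(R)` is one-dimensional over `κ`: `Module.finrank κ κ(R) = 1` and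
`κ(R)` is finite over `κ`. [folklore] -/
theorem finrank_residueField_eq_one
    (hres : ∀ r : R, ∃ c : κ, r - algebraMap κ R c ∈ maximalIdeal R) :
    Module.Finite κ (ResidueField R) ∧ Module.finrank κ (ResidueField R) = 1 := by
  let e : κ ≃ₗ[κ] ResidueField R :=
    LinearEquiv.ofBijective (Algebra.linearMap κ (ResidueField R))
      (bijective_algebraMap_residueField_of_forall_sub_mem hres)
  exact ⟨Module.Finite.equiv e, by rw [← e.finrank_eq, Module.finrank_self]⟩

/-- Under the same hypothesis the residue extension `κ(κ) = κ → κ(R)` has length one: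
`ℓ_{κ(κ)}(κ(R)) = 1` (the factor in `IsLocalRing.length_restrictScalars`). [folklore] -/
theorem length_residueField_eq_one
    (hres : ∀ r : R, ∃ c : κ, r - algebraMap κ R c ∈ maximalIdeal R) :
    haveI := isLocalHom_algebraMap_of_field (κ := κ) (R := R)
    Module.length (ResidueField κ) (ResidueField R) = 1 := by
  haveI := isLocalHom_algebraMap_of_field (κ := κ) (R := R)
  obtain ⟨hfin, h1⟩ := finrank_residueField_eq_one hres
  rw [← Module.length_eq_of_surjective (S := κ) (R := ResidueField κ) (M := ResidueField R)
    residue_surjective, Module.length_eq_finrank, h1, Nat.cast_one]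

/-- **Length equals dimension over the ground field.** Let `R` be a local algebra over a field `κ`
such that every element of `R` is congruent to a scalar modulo `𝔪_R` (residue field `κ`). For every
`R`-module `M` that is finite-dimensional over `κ`, `ℓ_R(M) = dim_κ M`.
[cite: Fulton1998, Appendix A.1, Lemma A.1.3] -/
theorem length_eq_finrank_of_residueField
    (hres : ∀ r : R, ∃ c : κ, r - algebraMap κ R c ∈ maximalIdeal R)
    (M : Type*) [AddCommGroup M] [Module R M] [Module κ M] [IsScalarTower κ R M]
    [Module.Finite κ M] : Module.length R M = Module.finrank κ M := by
  haveI := isLocalHom_algebraMap_of_field (κ := κ) (R := R)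
  have h := IsLocalRing.length_restrictScalars κ R M
  rw [length_residueField_eq_one hres, mul_one, Module.length_eq_finrank] at h
  exact h.symm

/-- **A finite-length module over such an `R` is finite-dimensional over `κ`** (so that
`length_eq_finrank_of_residueField` applies). [cite: Fulton1998, Appendix A.1, Lemma A.1.3] -/
theorem finite_of_length_ne_top_of_residueField
    (hres : ∀ r : R, ∃ c : κ, r - algebraMap κ R c ∈ maximalIdeal R)
    (M : Type*) [AddCommGroup M] [Module R M] [Module κ M] [IsScalarTower κ R M]
    (hM : Module.length R M ≠ ⊤) : Module.Finite κ M := by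
  haveI := isLocalHom_algebraMap_of_field (κ := κ) (R := R)
  have h := IsLocalRing.length_restrictScalars κ R M
  rw [length_residueField_eq_one hres, mul_one] at h
  rw [← h, Module.length_ne_top_iff, isFiniteLength_iff_isNoetherian_isArtinian] at hM
  haveI := hM.1
  infer_instance

/-- **Length of a finite-length module over such an `R`, as a natural number, is its `κ`-dimension**:
combination of the two previous facts. [cite: Fulton1998, Appendix A.1, Lemma A.1.3] -/
theorem length_eq_finrank_of_length_ne_top
    (hres : ∀ r : R, ∃ c : κ, r - algebraMap κ R c ∈ maximalIdeal R)
    (M : Type*) [AddCommGroup M] [Module R M] [Module κ M] [IsScalarTower κ R M]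
    (hM : Module.length R M ≠ ⊤) : Module.length R M = Module.finrank κ M := by
  haveI := finite_of_length_ne_top_of_residueField hres M hM
  exact length_eq_finrank_of_residueField hres M

end Literature.RingTheory.Length
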